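import Literature.NumberTheory.LFunctions.SoundararajanContourPointwise
import Literature.Analysis.Complex.StaircaseSymmetric
import HarnessLib

/-!
# Soundararajan's contour: the Perron integral bounded by the block sums (Balazard–de Roton 2008, Prop. 22)

Topic `Literature/NumberTheory/LFunctions`; a brick of the reduction of
`Literature.NumberTheory.LFunctions.BalazardDeRoton2010_thm1` to the engine statements of
Soundararajan's method. We assemble the staircase bound
(`Literature.Analysis.Complex.StaircaseSymm.norm_integral_symm_staircase_le`, Cauchy's theorem under
RH for `f(z) = ζ(z)⁻¹x^z/(z − iτ)` on `Re z > ½`) over the path `𝒮_N` of M. Balazard, A. de Roton,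
arXiv:0810.3587 §8.2 / arXiv:0812.1689 §6.2, with the pointwise bounds of
`SoundararajanContourPointwise.lean`, into the twisted form of their Proposition 22
(arXiv:0810.3587 §8.3) used in arXiv:0812.1689 §6.2 ("Troisième étape"): for `|τ| ≤ T/4`,

`‖∫_{-T}^{T} ζ(c+iu)⁻¹ x^{c+iu}/(c+iu−iτ) du‖ ≤ √x·(24 Σ_{N₀ ≤ n < T} e^{E_n} (1/(1+|n−τ|) + 1/(1+|n+τ|)) + 16 N₀ Z_mid)`
`  + 32 (e^{E_{T−1}} + e^{D V_{T−1} δ⁻¹})`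

(`SoundContour.norm_perron_integral_le`), where `c = 1 + 1/log x`, `N₀ = 2^κ`, `T = 2^K`,
`E_n = blockExp δ D₂ (log(log x/log T_k)) V_n` on the dyadic block `T_k ≤ n < 2T_k` (`blockE`),
`V_n` the ladder of `TypicalOrdinateLadder.lean` (`lad`), and `Z_mid` the bound of the first segment.
The dyadic evaluation of the block sums (Prop. 24) and the choice of `κ, K` in terms of `N` are done
in the sequel; here everything is uniform in the abstract thresholds (`GoodSize`, `MidGood`,
a bound `hsmall` for `|Im z| ≤ t₀` as supplied by `InvZetaSmallOrdinatesRH.lean`).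

## References

* [BalazardRoton2008] M. Balazard, A. de Roton, arXiv:0810.3587, §8.2 (the path), §8.3 (Prop. 22).
* [BalazardDeRoton2010] M. Balazard, A. de Roton, arXiv:0812.1689, §6.2 (twisted version, (t46)).
-/

noncomputable section

open Complex Real Set MeasureTheory intervalIntegral Finset
open scoped Interval

namespace Literature.NumberTheory.LFunctions

namespace SoundContour

open Soundararajan TypicalLadder TypicalPointwise TypicalLevelSets MertensBoundRH
open Literature.Analysis.Complex

/-! ### The dyadic data attached to an integer `n` -/

/-- The dyadic block base `T_k = 2^{⌊log₂ n⌋}` of `n`. [cite: BalazardRoton2008, §8.2] -/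
def bbase (n : ℕ) : ℕ := 2 ^ Nat.log 2 n

/-- `V_n`: the ladder of `[n, n+1]` at its dyadic size `T_k`. [cite: BalazardRoton2008, §8.2] -/
def lad (δ : ℝ) (n : ℕ) : ℕ := ladder δ (bbase n : ℝ) n

/-- `E_n = blockExp δ D₂ (log(L/log T_k)) V_n`, the exponent of the block of `n` (`L = log x`).
[cite: BalazardRoton2008, §8.3] -/
def blockE (δ D₂ L : ℝ) (n : ℕ) : ℝ :=
  blockExp δ D₂ (Real.log (L / Real.log (bbase n : ℝ))) (lad δ n)

/-- The abscissa `σ_n = ½ + V_n/L` of the vertical unit segment over `[n, n+1]` (with `max 1 V_n`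
so that `σ_n > ½` for every `n`; on the range used, `V_n ≥ 4`). [cite: BalazardRoton2008, §8.2] -/
def absc (δ L : ℝ) (n : ℕ) : ℝ := 1 / 2 + max 1 (lad δ n : ℝ) / L

/-- Largeness of a size `t` ("`T` assez grand"): the thresholds of Props. 1 and 18, `t ≥ e^{e²}`,
and the three elementary inequalities making `V*(t)` admissible (`TypicalLadder.admissible_vStar`).
[folklore] -/
def GoodSize (T₁ T₁₈ t : ℝ) : Prop :=
  T₁ ≤ t ∧ T₁₈ ≤ t ∧ Real.exp (Real.exp 2) ≤ t ∧
    0 ≤ 1 / 2 + Real.log (Real.log (Real.log t)) / Real.log (Real.log t) ∧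
    Real.log (Real.log t) ^ 2 ≤ (1 / 2 + Real.log (Real.log (Real.log t)) / Real.log (Real.log t)) *
      Real.log t / Real.log (Real.log t) ∧
    (1 / 2 + Real.log (Real.log (Real.log t)) / Real.log (Real.log t)) * Real.log t /
        Real.log (Real.log t) + 1 ≤ Real.log t / Real.log (Real.log t)

/-- Largeness of a height `t` on the first segment (thresholds of Props. 1, 18 and the elementary
inequalities of `SoundContour.norm_inv_zeta_mid_le`). [folklore] -/
def MidGood (T₁ T₁₈ t : ℝ) : Prop :=
  T₁ ≤ t ∧ T₁₈ ≤ t ∧ 4 ≤ Real.log (Real.log t) ∧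
    2 * Real.log (Real.log (Real.log t)) ≤ Real.log (Real.log t) ∧ Real.log (Real.log t) ^ 3 ≤ Real.log t

/-- Arithmetic of the dyadic blocks: for `N₀ = 2^κ ≤ n < T = 2^K`,
`N₀ ≤ T_k ≤ n`, `n + 1 ≤ 2T_k ≤ T`. [folklore] -/
lemma bbase_facts {N₀ T κ K n : ℕ} (hN₀ : N₀ = 2 ^ κ) (hT : T = 2 ^ K) (h1 : N₀ ≤ n) (h2 : n < T) :
    N₀ ≤ bbase n ∧ bbase n ≤ n ∧ n + 1 ≤ 2 * bbase n ∧ 2 * bbase n ≤ T := by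
  have hn0 : n ≠ 0 := by
    intro h; rw [h, hN₀] at h1; exact absurd h1 (not_le.2 (Nat.two_pow_pos κ))
  refine ⟨?_, Nat.pow_log_le_self 2 hn0, ?_, ?_⟩
  · rw [hN₀, bbase]
    exact Nat.pow_le_pow_right two_pos (Nat.le_log_of_pow_le one_lt_two (hN₀ ▸ h1))
  · have := Nat.lt_pow_succ_log_self one_lt_two n
    rw [bbase, show 2 * 2 ^ Nat.log 2 n = 2 ^ (Nat.log 2 n).succ by rw [pow_succ]; ring]
    exact this
  · rw [hT, bbase, show 2 * 2 ^ Nat.log 2 n = 2 ^ (Nat.log 2 n + 1) by rw [pow_succ]; ring]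
    exact Nat.pow_le_pow_right two_pos (Nat.log_lt_of_lt_pow hn0 (hT ▸ h2))

/-- The ladder data of `n`: if its block base is good, `V_n` is admissible and
`4 ≤ V_n ≤ log T_k/log log T_k ≤ log T_k`, `V_n ≤ (½ + L₃/L₂) log T_k/L₂ T_k + 1`. [folklore] -/
lemma lad_facts {δ T₁ T₁₈ : ℝ} (h18 : Prop18With δ T₁₈) {n : ℕ} (hg : GoodSize T₁ T₁₈ (bbase n))
    (hb1 : bbase n ≤ n) (hb2 : n + 1 ≤ 2 * bbase n) :
    Admissible δ (bbase n : ℝ) n (lad δ n) ∧ 4 ≤ (lad δ n : ℝ) ∧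
      (lad δ n : ℝ) ≤ Real.log (bbase n : ℝ) / Real.log (Real.log (bbase n : ℝ)) ∧
      (lad δ n : ℝ) ≤ Real.log (bbase n : ℝ) ∧
      (lad δ n : ℝ) ≤ (1 / 2 + Real.log (Real.log (Real.log (bbase n : ℝ))) /
        Real.log (Real.log (bbase n : ℝ))) * Real.log (bbase n : ℝ) / Real.log (Real.log (bbase n : ℝ)) + 1 := by
  obtain ⟨-, hT₁₈, hTe, hbase, ha, hb⟩ := hg
  obtain ⟨hL2, hLT, hT0, hT1', h7⟩ := size_facts hTe
  have hn1 : (bbase n : ℝ) ≤ n := by exact_mod_cast hb1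
  have hn2 : (n : ℝ) + 1 ≤ 2 * (bbase n : ℝ) := by exact_mod_cast hb2
  obtain ⟨hadm, hle⟩ := ladder_le_vStar h18 hT₁₈ (by linarith) (by linarith) hbase ha hb hn1 hn2
  obtain ⟨h4, hup, hlog⟩ := admissible_sizes hTe hadm
  exact ⟨hadm, h4, hup, hlog, hle⟩

/-! ### `L¹` pieces -/

/-- `|∫_a^b ‖g‖| ≤ C|b − a|` from a pointwise bound on `Ι a b`. [folklore] -/
lemma abs_integral_norm_le {g : ℝ → ℂ} {a b C : ℝ} (h : ∀ u ∈ Ι a b, ‖g u‖ ≤ C) :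
    |∫ u in a..b, ‖g u‖| ≤ C * |b - a| := by
  have := intervalIntegral.norm_integral_le_of_norm_le_const (f := fun u ↦ ‖g u‖) (a := a) (b := b)
    (C := C) (fun u hu ↦ by rw [norm_norm]; exact h u hu)
  rwa [Real.norm_eq_abs] at this

/-- `1/(1+|n−τ|) ≤ 2/(1+|n+1−τ|)` and the same with `+τ`. [folklore] -/
lemma weight_shift (n τ : ℝ) :
    1 / (1 + |n - τ|) ≤ 2 * (1 / (1 + |n + 1 - τ|)) ∧
      1 / (1 + |n + τ|) ≤ 2 * (1 / (1 + |n + 1 + τ|)) := by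
  constructor
  · rw [mul_one_div, div_le_div_iff₀ (by positivity) (by positivity)]
    have : |n + 1 - τ| ≤ |n - τ| + 1 := by
      have := abs_add_le (n - τ) 1
      rw [show n - τ + 1 = n + 1 - τ by ring, abs_one] at this; exact this
    linarith [abs_nonneg (n - τ)]
  · rw [mul_one_div, div_le_div_iff₀ (by positivity) (by positivity)]
    have : |n + 1 + τ| ≤ |n + τ| + 1 := by
      have := abs_add_le (n + τ) 1
      rw [show n + τ + 1 = n + 1 + τ by ring, abs_one] at this; exact this
    linarith [abs_nonneg (n + τ)]


/-! ### Basic sizes -/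

/-- Sizes implied by the standing hypotheses: `2 ≤ N₀`, `2N₀ ≤ T`, `1 < x`, `log T ≤ log x`.
[folklore] -/
lemma setup_facts {N₀ T κ K : ℕ} (hN₀ : N₀ = 2 ^ κ) (hT : T = 2 ^ K) (hκ : 1 ≤ κ) (hκK : κ < K)
    {x : ℝ} (hTx : (T : ℝ) ≤ x) :
    2 ≤ N₀ ∧ 2 * N₀ ≤ T ∧ (N₀ : ℝ) + 2 ≤ T ∧ 0 < x ∧ 1 < x ∧ (1 : ℝ) ≤ N₀ ∧
      Real.log (N₀ : ℝ) < Real.log x ∧ Real.log (T : ℝ) ≤ Real.log x := by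
  have hN₀2 : 2 ≤ N₀ := by
    rw [hN₀]; calc 2 = 2 ^ 1 := by norm_num
      _ ≤ 2 ^ κ := Nat.pow_le_pow_right two_pos hκ
  have h2N₀ : 2 * N₀ ≤ T := by
    rw [hN₀, hT, show 2 * 2 ^ κ = 2 ^ (κ + 1) by rw [pow_succ]; ring]
    exact Nat.pow_le_pow_right two_pos hκK
  have hN₀T : (N₀ : ℝ) + 2 ≤ T := by
    have : N₀ + 2 ≤ T := by omega
    exact_mod_cast this
  have hN₀1 : (1 : ℝ) ≤ N₀ := by exact_mod_cast (show 1 ≤ N₀ by omega)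
  have hx0 : 0 < x := by linarith
  have hx1 : 1 < x := by linarith
  have hNT : (N₀ : ℝ) < T := by linarith
  refine ⟨hN₀2, h2N₀, hN₀T, hx0, hx1, hN₀1, ?_, Real.log_le_log (by linarith) hTx⟩
  exact (Real.log_lt_log (by linarith) hNT).trans_le (Real.log_le_log (by linarith) hTx)

/-- On the range `N₀ ≤ n < T` the abscissa is `σ_n = ½ + V_n/L` with `4 ≤ V_n ≤ log T_k ≤ L`,
hence `½ < σ_n ≤ 3/2`. [folklore] -/
lemma absc_eq {δ L : ℝ} {n : ℕ} (h4 : 4 ≤ (lad δ n : ℝ)) : absc δ L n = 1 / 2 + (lad δ n : ℝ) / L := by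
  rw [absc, max_eq_right (by linarith)]

/-- `σ_n > ½` for every `n` (when `L > 0`). [folklore] -/
lemma half_lt_absc {δ L : ℝ} (hL : 0 < L) (n : ℕ) : 1 / 2 < absc δ L n := by
  rw [absc]
  have : 0 < max 1 (lad δ n : ℝ) / L := div_pos (lt_of_lt_of_le one_pos (le_max_left _ _)) hL
  linarith

section pieces

variable {δ D T₁ T₁₈ : ℝ} {N₀ T κ K : ℕ} {x τ : ℝ}

/-- Block data for `n ∈ [N₀, T)` under the standing hypotheses. [folklore] -/
lemma block_data (h18 : Prop18With δ T₁₈) (hN₀ : N₀ = 2 ^ κ) (hT : T = 2 ^ K)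
    (hTx : (T : ℝ) ≤ x) (hgood : ∀ t : ℝ, (N₀ : ℝ) ≤ t → t ≤ x → GoodSize T₁ T₁₈ t)
    {n : ℕ} (h1 : N₀ ≤ n) (h2 : n < T) :
    (N₀ ≤ bbase n ∧ bbase n ≤ n ∧ n + 1 ≤ 2 * bbase n ∧ 2 * bbase n ≤ T) ∧
      GoodSize T₁ T₁₈ (bbase n) ∧ Admissible δ (bbase n : ℝ) n (lad δ n) ∧ 4 ≤ (lad δ n : ℝ) ∧
      (lad δ n : ℝ) ≤ Real.log (bbase n : ℝ) / Real.log (Real.log (bbase n : ℝ)) ∧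
      (lad δ n : ℝ) ≤ Real.log (bbase n : ℝ) ∧ Real.log (bbase n : ℝ) ≤ Real.log x ∧
      (bbase n : ℝ) ≤ n ∧ (n : ℝ) + 1 ≤ T := by
  obtain ⟨hNb, hb1, hb2, hbT⟩ := bbase_facts hN₀ hT h1 h2
  have hbx : (bbase n : ℝ) ≤ x := by
    have : (bbase n : ℝ) ≤ T := by exact_mod_cast (hb1.trans h2.le)
    linarith
  have hg := hgood (bbase n) (by exact_mod_cast hNb) hbx
  obtain ⟨hadm, h4, hup, hlog, -⟩ := lad_facts h18 hg hb1 hb2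
  have hb0 : (0 : ℝ) < bbase n := by
    obtain ⟨-, -, hT0, -⟩ := size_facts hg.2.2.1
    exact hT0
  refine ⟨⟨hNb, hb1, hb2, hbT⟩, hg, hadm, h4, hup, hlog, Real.log_le_log hb0 hbx,
    by exact_mod_cast hb1, by exact_mod_cast (show n + 1 ≤ T from h2)⟩

/-- **Vertical unit segments** (both signs): for `N₀ ≤ n < T`,
`|∫_n^{n+1} ‖f(σ_n+iu)‖ du| + |∫_{−(n+1)}^{−n} ‖f(σ_n+iu)‖ du| ≤ 6√x e^{E_n}(1/(1+|n−τ|) + 1/(1+|n+τ|))`.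
[cite: BalazardRoton2008, §8.3] -/
theorem vert_piece_le (hδ0 : 0 < δ) (hδ1 : δ ≤ 1) (hP1 : Prop1With δ D T₁) (h18 : Prop18With δ T₁₈)
    (hN₀ : N₀ = 2 ^ κ) (hT : T = 2 ^ K) (hTx : (T : ℝ) ≤ x) (hLx : 0 < Real.log x)
    (hgood : ∀ t : ℝ, (N₀ : ℝ) ≤ t → t ≤ x → GoodSize T₁ T₁₈ t) {n : ℕ} (h1 : N₀ ≤ n) (h2 : n < T) :
    |∫ u in (n : ℝ)..((n : ℝ) + 1), ‖integrand x τ (absc δ (Real.log x) n + u * I)‖| +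
        |∫ u in (-((n : ℝ) + 1))..(-(n : ℝ)), ‖integrand x τ (absc δ (Real.log x) n + u * I)‖| ≤
      6 * Real.sqrt x * Real.exp (blockE δ (max D 0 + 2) (Real.log x) n) *
        (1 / (1 + |(n : ℝ) - τ|) + 1 / (1 + |(n : ℝ) + τ|)) := by
  obtain ⟨⟨hNb, hb1, hb2, hbT⟩, hg, hadm, h4, hup, hlog, hlogx, hbn, hnT⟩ :=
    block_data h18 hN₀ hT hTx hgood h1 h2
  obtain ⟨hT₁, -, hTe, -⟩ := hg
  have hσ : absc δ (Real.log x) n = 1 / 2 + (lad δ n : ℝ) / Real.log x := absc_eq h4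
  have hn1 : (1 : ℝ) ≤ n := by
    obtain ⟨-, -, hb0, hb1', -⟩ := size_facts hTe
    linarith
  set C : ℝ := Real.sqrt x * Real.exp (blockE δ (max D 0 + 2) (Real.log x) n) with hC
  have hC0 : 0 ≤ C := by positivity
  -- pointwise bound on the strip `n ≤ |Im z| ≤ n+1`
  have hpt : ∀ u : ℝ, (n : ℝ) ≤ |u| → |u| ≤ n + 1 → ∀ W : ℝ,
      1 ≤ W * ‖(absc δ (Real.log x) n : ℂ) + u * I - τ * I‖ →
      ‖integrand x τ (absc δ (Real.log x) n + u * I)‖ ≤ C * W := by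
    intro u hu1 hu2 W hW
    have hux : |u| ≤ x := by linarith
    have hz : |((absc δ (Real.log x) n : ℂ) + u * I).im| = |u| := by simp
    have hzre : ((absc δ (Real.log x) n : ℂ) + u * I).re = 1 / 2 + (lad δ n : ℝ) / Real.log x := by
      simp [hσ]
    have hB := norm_vert_le hδ0 hδ1 hP1 hT₁ hTe hadm hbn hu1 hu2 hux hz hzre
    refine norm_integrand_le ?_ ?_ hB hW
    · intro h
      have := congrArg Complex.im h
      simp at this
      rw [this, abs_zero] at hu1; linarith
    · rw [hzre]; have : 0 ≤ (lad δ n : ℝ) / Real.log x := by positivity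
      linarith
  have hre : ∀ u : ℝ, 1 / 2 ≤ ((absc δ (Real.log x) n : ℂ) + u * I).re := fun u ↦ by
    simp only [add_re, ofReal_re, mul_re, I_re, mul_zero, ofReal_im, I_im, mul_one, sub_self,
      add_zero]
    exact (half_lt_absc hLx n).le
  -- upper segment
  have hup' : |∫ u in (n : ℝ)..((n : ℝ) + 1), ‖integrand x τ (absc δ (Real.log x) n + u * I)‖| ≤
      C * (6 * (1 / (1 + |(n : ℝ) - τ|))) := by
    have h := abs_integral_norm_le (g := fun u ↦ integrand x τ (absc δ (Real.log x) n + u * I))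
      (a := n) (b := (n : ℝ) + 1) (C := C * (6 * (1 / (1 + |(n : ℝ) - τ|)))) (fun u hu ↦ ?_)
    · simpa using h
    · rw [uIoc_of_le (by linarith), Set.mem_Ioc] at hu
      have hu0 : 0 ≤ u := by linarith
      refine hpt u (by rw [abs_of_nonneg hu0]; exact hu.1.le) (by rw [abs_of_nonneg hu0]; exact hu.2)
        _ ?_
      have hgeo := one_add_abs_sub_le (τ := τ) (hre u) (n := n) (by simp; exact hu.1.le)
        (by simp; exact hu.2)
      rw [mul_one_div, div_mul_eq_mul_div, le_div_iff₀ (by positivity)]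
      linarith
  -- lower segment
  have hlow' : |∫ u in (-((n : ℝ) + 1))..(-(n : ℝ)), ‖integrand x τ (absc δ (Real.log x) n + u * I)‖| ≤
      C * (6 * (1 / (1 + |(n : ℝ) + τ|))) := by
    have h := abs_integral_norm_le (g := fun u ↦ integrand x τ (absc δ (Real.log x) n + u * I))
      (a := -((n : ℝ) + 1)) (b := -(n : ℝ)) (C := C * (6 * (1 / (1 + |(n : ℝ) + τ|)))) (fun u hu ↦ ?_)
    · have e : |-(n : ℝ) - -((n : ℝ) + 1)| = 1 := by ring_nf; simp
      rw [e, mul_one] at h; exact h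
    · rw [uIoc_of_le (by linarith), Set.mem_Ioc] at hu
      have hu0 : u ≤ 0 := by linarith
      have habs : |u| = -u := abs_of_nonpos hu0
      refine hpt u (by rw [habs]; linarith) (by rw [habs]; linarith) _ ?_
      have hgeo := one_add_abs_add_le (τ := τ) (hre u) (n := n) (by simp; linarith)
        (by simp; linarith)
      rw [mul_one_div, div_mul_eq_mul_div, le_div_iff₀ (by positivity)]
      linarith
  have e : 6 * Real.sqrt x * Real.exp (blockE δ (max D 0 + 2) (Real.log x) n) *
      (1 / (1 + |(n : ℝ) - τ|) + 1 / (1 + |(n : ℝ) + τ|)) =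
      C * (6 * (1 / (1 + |(n : ℝ) - τ|))) + C * (6 * (1 / (1 + |(n : ℝ) + τ|))) := by
    rw [hC]; ring
  rw [e]; exact add_le_add hup' hlow'

/-- **Horizontal connectors at heights `±(n+1)`**: for `N₀ ≤ n < T − 1`,
`|∫_{σ_n}^{σ_{n+1}} ‖f(v + i(n+1))‖| + |∫_{σ_{n+1}}^{σ_n} ‖f(v − i(n+1))‖|`
`≤ 6√x (e^{E_n} + e^{E_{n+1}})(1/(1+|n−τ|) + 1/(1+|n+τ|))`. [cite: BalazardRoton2008, §8.3] -/
theorem conn_piece_le (hδ0 : 0 < δ) (hδ1 : δ ≤ 1) (hP1 : Prop1With δ D T₁) (h18 : Prop18With δ T₁₈)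
    (hN₀ : N₀ = 2 ^ κ) (hT : T = 2 ^ K) (hTx : (T : ℝ) ≤ x) (hLx : 0 < Real.log x)
    (hgood : ∀ t : ℝ, (N₀ : ℝ) ≤ t → t ≤ x → GoodSize T₁ T₁₈ t) {n : ℕ} (h1 : N₀ ≤ n)
    (h2 : n + 1 < T) :
    |∫ v in (absc δ (Real.log x) n)..(absc δ (Real.log x) (n + 1)),
        ‖integrand x τ (v + (((n : ℝ) + 1 : ℝ) : ℂ) * I)‖| +
      |∫ v in (absc δ (Real.log x) (n + 1))..(absc δ (Real.log x) n),
        ‖integrand x τ (v + ((-((n : ℝ) + 1) : ℝ) : ℂ) * I)‖| ≤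
      6 * Real.sqrt x * (Real.exp (blockE δ (max D 0 + 2) (Real.log x) n) +
          Real.exp (blockE δ (max D 0 + 2) (Real.log x) (n + 1))) *
        (1 / (1 + |(n : ℝ) - τ|) + 1 / (1 + |(n : ℝ) + τ|)) := by
  obtain ⟨⟨hNb, hb1, hb2, hbT⟩, hg, hadm, h4, hup, hlog, hlogx, hbn, hnT⟩ :=
    block_data h18 hN₀ hT hTx hgood h1 (by omega)
  obtain ⟨⟨hNb', hb1', hb2', hbT'⟩, hg', hadm', h4', hup', hlog', hlogx', hbn', hnT'⟩ :=
    block_data h18 hN₀ hT hTx hgood (show N₀ ≤ n + 1 by omega) h2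
  obtain ⟨hT₁, -, hTe, -⟩ := hg
  obtain ⟨hT₁', -, hTe', -⟩ := hg'
  set L := Real.log x with hLdef
  have hσn : absc δ L n = 1 / 2 + (lad δ n : ℝ) / L := absc_eq h4
  have hσm : absc δ L (n + 1) = 1 / 2 + (lad δ (n + 1) : ℝ) / L := absc_eq h4'
  have hn1x : (n : ℝ) + 1 ≤ x := by
    have : (n : ℝ) + 1 + 1 ≤ T := by exact_mod_cast h2
    linarith
  set C : ℝ := Real.sqrt x * (Real.exp (blockE δ (max D 0 + 2) L n) +
    Real.exp (blockE δ (max D 0 + 2) L (n + 1))) with hC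
  have hC0 : 0 ≤ C := by positivity
  -- lengths: `|σ_{n+1} − σ_n| ≤ 1`
  have hlen : |absc δ L (n + 1) - absc δ L n| ≤ 1 := by
    rw [hσn, hσm]
    have a1 : (lad δ n : ℝ) / L ≤ 1 := by rw [div_le_one hLx]; exact hlog.trans hlogx
    have a2 : (lad δ (n + 1) : ℝ) / L ≤ 1 := by rw [div_le_one hLx]; exact hlog'.trans hlogx'
    have b1 : 0 ≤ (lad δ n : ℝ) / L := by positivity
    have b2 : 0 ≤ (lad δ (n + 1) : ℝ) / L := by positivity
    rw [abs_le]; constructor <;> linarith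
  have hlen' : |absc δ L n - absc δ L (n + 1)| ≤ 1 := by rw [abs_sub_comm]; exact hlen
  -- pointwise bound at height `±(n+1)` for `v` between the abscissae
  have hpt : ∀ v : ℝ, v ∈ Ι (absc δ L n) (absc δ L (n + 1)) → ∀ s : ℝ, |s| = (n : ℝ) + 1 →
      ∀ W : ℝ, 1 ≤ W * ‖(v : ℂ) + s * I - τ * I‖ → ‖integrand x τ (v + s * I)‖ ≤ C * W := by
    intro v hv s hs W hW
    rw [Set.mem_uIoc] at hv
    have hz : |((v : ℂ) + s * I).im| = (n : ℝ) + 1 := by simpa using hs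
    have hzre : ((v : ℂ) + s * I).re = v := by simp
    -- `(v − ½)L` lies between `V_n` and `V_{n+1}`
    have hv1 : min (lad δ n : ℝ) (lad δ (n + 1)) ≤ (((v : ℂ) + s * I).re - 1 / 2) * L := by
      rw [hzre]
      rcases hv with ⟨ha, hb⟩ | ⟨ha, hb⟩
      · rw [hσn] at ha
        have : (lad δ n : ℝ) ≤ (v - 1 / 2) * L := by
          rw [← div_le_iff₀ hLx]; linarith
        exact (min_le_left _ _).trans this
      · rw [hσm] at ha
        have : (lad δ (n + 1) : ℝ) ≤ (v - 1 / 2) * L := by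
          rw [← div_le_iff₀ hLx]; linarith
        exact (min_le_right _ _).trans this
    have hv2 : (((v : ℂ) + s * I).re - 1 / 2) * L ≤ max (lad δ n : ℝ) (lad δ (n + 1)) := by
      rw [hzre]
      rcases hv with ⟨ha, hb⟩ | ⟨ha, hb⟩
      · rw [hσm] at hb
        have : (v - 1 / 2) * L ≤ (lad δ (n + 1) : ℝ) := by
          rw [← le_div_iff₀ hLx]; linarith
        exact this.trans (le_max_right _ _)
      · rw [hσn] at hb
        have : (v - 1 / 2) * L ≤ (lad δ n : ℝ) := by
          rw [← le_div_iff₀ hLx]; linarith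
        exact this.trans (le_max_left _ _)
    have hbn'' : (bbase (n + 1) : ℝ) ≤ (n : ℝ) + 1 := by exact_mod_cast hb1'
    have hB := norm_conn_le hδ0 hδ1 hP1 hT₁ hTe hT₁' hTe' hadm hadm' hbn hbn'' hn1x hz hv1 hv2
    have hre : 1 / 2 ≤ ((v : ℂ) + s * I).re := by
      rw [hzre]
      have h1 := half_lt_absc (δ := δ) hLx n
      have h2 := half_lt_absc (δ := δ) hLx (n + 1)
      rcases hv with ⟨ha, -⟩ | ⟨ha, -⟩ <;> linarith
    refine norm_integrand_le ?_ hre hB hW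
    intro h
    have := congrArg Complex.im h
    simp at this
    rw [this, abs_zero] at hs; linarith
  have hvhalf : ∀ v : ℝ, v ∈ Ι (absc δ L n) (absc δ L (n + 1)) → 1 / 2 ≤ v := by
    intro v hv
    have h1 := half_lt_absc (δ := δ) hLx n
    have h2 := half_lt_absc (δ := δ) hLx (n + 1)
    rcases Set.mem_uIoc.1 hv with ⟨ha, -⟩ | ⟨ha, -⟩ <;> linarith
  -- upper connector
  have hup'' : |∫ v in (absc δ L n)..(absc δ L (n + 1)),
      ‖integrand x τ (v + (((n : ℝ) + 1 : ℝ) : ℂ) * I)‖| ≤ C * (6 * (1 / (1 + |(n : ℝ) - τ|))) := by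
    have h := abs_integral_norm_le
      (g := fun v : ℝ ↦ integrand x τ (v + (((n : ℝ) + 1 : ℝ) : ℂ) * I))
      (a := absc δ L n) (b := absc δ L (n + 1)) (C := C * (6 * (1 / (1 + |(n : ℝ) - τ|))))
      (fun v hv ↦ ?_)
    · exact h.trans (mul_le_of_le_one_right (by positivity) hlen)
    · refine hpt v hv ((n : ℝ) + 1) (abs_of_nonneg (by positivity)) _ ?_
      have hgeo := one_add_abs_sub_le (τ := τ) (z := (v : ℂ) + (((n : ℝ) + 1 : ℝ) : ℂ) * I)
        (n := n) (by simpa using hvhalf v hv) (by simp) (by simp)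
      rw [mul_one_div, div_mul_eq_mul_div, le_div_iff₀ (by positivity)]
      linarith
  -- lower connector
  have hlow'' : |∫ v in (absc δ L (n + 1))..(absc δ L n),
      ‖integrand x τ (v + ((-((n : ℝ) + 1) : ℝ) : ℂ) * I)‖| ≤ C * (6 * (1 / (1 + |(n : ℝ) + τ|))) := by
    have h := abs_integral_norm_le
      (g := fun v : ℝ ↦ integrand x τ (v + ((-((n : ℝ) + 1) : ℝ) : ℂ) * I))
      (a := absc δ L (n + 1)) (b := absc δ L n) (C := C * (6 * (1 / (1 + |(n : ℝ) + τ|))))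
      (fun v hv ↦ ?_)
    · exact h.trans (mul_le_of_le_one_right (by positivity) hlen')
    · rw [Set.uIoc_comm] at hv
      refine hpt v hv (-((n : ℝ) + 1)) (by rw [abs_neg]; exact abs_of_nonneg (by positivity)) _ ?_
      have hgeo := one_add_abs_add_le (τ := τ) (z := (v : ℂ) + ((-((n : ℝ) + 1) : ℝ) : ℂ) * I)
        (n := n) (by simpa using hvhalf v hv) (by simp) (by simp)
      rw [mul_one_div, div_mul_eq_mul_div, le_div_iff₀ (by positivity)]
      linarith
  have e : 6 * Real.sqrt x * (Real.exp (blockE δ (max D 0 + 2) L n) +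
      Real.exp (blockE δ (max D 0 + 2) L (n + 1))) * (1 / (1 + |(n : ℝ) - τ|) + 1 / (1 + |(n : ℝ) + τ|)) =
      C * (6 * (1 / (1 + |(n : ℝ) - τ|))) + C * (6 * (1 / (1 + |(n : ℝ) + τ|))) := by
    rw [hC]; ring
  rw [e]; exact add_le_add hup'' hlow''

/-! ### The first segment and its connectors -/

/-- `a/log a ≤ b/log b` for `e ≤ a ≤ b`. [folklore] -/
lemma div_log_mono {a b : ℝ} (ha : Real.exp 1 ≤ a) (hab : a ≤ b) :
    a / Real.log a ≤ b / Real.log b := by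
  have ha0 : 0 < a := (Real.exp_pos 1).trans_le ha
  have hb0 : 0 < b := ha0.trans_le hab
  have hla : 0 < Real.log a := Real.log_pos (lt_of_lt_of_le (by
    have := Real.exp_one_gt_d9; linarith) ha)
  have hlb : 0 < Real.log b := hla.trans_le (Real.log_le_log ha0 hab)
  have h := Real.log_div_self_antitoneOn ha (ha.trans hab) hab
  -- `log b / b ≤ log a / a`
  have e1 : a / Real.log a = 1 / (Real.log a / a) := by field_simp
  have e2 : b / Real.log b = 1 / (Real.log b / b) := by field_simp
  rw [e1, e2]
  exact one_div_le_one_div_of_le (div_pos hlb hb0) h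

/-- `(1/L)^{−M} = L^M`. [folklore] -/
lemma one_div_rpow_neg_nat {L : ℝ} (hL : 0 < L) (M : ℕ) : (1 / L) ^ (-(M : ℝ)) = L ^ M := by
  rw [Real.rpow_neg (by positivity), Real.rpow_natCast, one_div_pow, inv_div, div_one]

/-- **`ζ⁻¹` on the first segment and its connectors.** Let `Z_m = C_a L^M + Z₁(N₀)`,
`Z₁(N₀) = exp((log N₀/log log N₀)(log L + 2(1+δ) log log log N₀ + Dδ⁻²))`. If `1/L ≤ σ − ½`,
`σ < 1`, `|u| ≤ N₀ ≤ x`, and (when `|u| > t₀`) `σ − ½ ≤ 1/log log |u|`, then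
`‖ζ(σ + iu)⁻¹‖ ≤ Z_m` (from `hsmall` for `|u| ≤ t₀`, from Props. 1, 18 otherwise).
[cite: BalazardRoton2008, §8.3] -/
theorem norm_inv_zeta_first_le (hRH : RiemannHypothesis) (hδ0 : 0 < δ) (hD : 0 ≤ D)
    (hP1 : Prop1With δ D T₁) (h18 : Prop18With δ T₁₈) {t₀ Ca L σ u : ℝ} {M : ℕ} {N₀ : ℕ}
    (hCa : 0 ≤ Ca)
    (hsmall : ∀ σ t : ℝ, 1 / 2 < σ → σ < 1 → |t| ≤ t₀ →
      ‖(riemannZeta (σ + t * I))⁻¹‖ ≤ Ca * (σ - 1 / 2) ^ (-(M : ℝ)))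
    (hmid : ∀ t : ℝ, t₀ < t → t ≤ x → MidGood T₁ T₁₈ t) (hN₀e : Real.exp (Real.exp 2) ≤ N₀)
    (hN₀x : (N₀ : ℝ) ≤ x) (hL4 : 4 ≤ L) (hσ1 : 1 / L ≤ σ - 1 / 2) (hσlt : σ < 1) (hu : |u| ≤ N₀)
    (hσ2 : t₀ < |u| → σ - 1 / 2 ≤ 1 / Real.log (Real.log |u|)) :
    ‖(riemannZeta (σ + u * I))⁻¹‖ ≤
      Ca * L ^ M + Real.exp (Real.log N₀ / Real.log (Real.log N₀) *
        (Real.log L + 2 * (1 + δ) * Real.log (Real.log (Real.log N₀)) + D * δ⁻¹ ^ 2)) := by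
  have hL0 : 0 < L := by linarith
  have hσhalf : 1 / 2 < σ := by
    have : 0 < 1 / L := by positivity
    linarith
  have hZ₁ : 0 ≤ Real.exp (Real.log N₀ / Real.log (Real.log N₀) *
      (Real.log L + 2 * (1 + δ) * Real.log (Real.log (Real.log N₀)) + D * δ⁻¹ ^ 2)) :=
    (Real.exp_pos _).le
  have hCL : 0 ≤ Ca * L ^ M := by positivity
  rcases le_or_gt |u| t₀ with hut | hut
  · -- bounded height
    have h := hsmall σ u hσhalf hσlt hut
    have hmono : (σ - 1 / 2) ^ (-(M : ℝ)) ≤ (1 / L) ^ (-(M : ℝ)) :=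
      Real.rpow_le_rpow_of_nonpos (by positivity) hσ1 (by simp)
    rw [one_div_rpow_neg_nat hL0] at hmono
    calc ‖(riemannZeta (σ + u * I))⁻¹‖ ≤ Ca * (σ - 1 / 2) ^ (-(M : ℝ)) := h
      _ ≤ Ca * L ^ M := mul_le_mul_of_nonneg_left hmono hCa
      _ ≤ _ := le_add_of_nonneg_right hZ₁
  · -- large height: Props. 1 and 18
    have hux : |u| ≤ x := hu.trans hN₀x
    obtain ⟨hT₁, hT₁₈, hL₂, hL₃, hcube⟩ := hmid |u| hut hux
    have h := norm_inv_zeta_mid_le hRH hδ0 hP1 h18 hT₁ hT₁₈ hL₂ hL₃ hcube (by linarith) hσ1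
      (hσ2 hut) (u := u) rfl
    refine h.trans (le_add_of_nonneg_of_le hCL (Real.exp_le_exp.2 ?_))
    -- monotonicity in the height
    obtain ⟨hN2, hNe2, hN0, hN1, hN7⟩ := size_facts hN₀e
    have hlu64 : 64 ≤ Real.log |u| := by
      have : (4 : ℝ) ^ 3 ≤ Real.log (Real.log |u|) ^ 3 := pow_le_pow_left₀ (by norm_num) hL₂ 3
      linarith
    have hu0 : 0 < |u| := by
      rcases lt_or_ge 0 |u| with h0 | h0
      · exact h0
      · have : |u| = 0 := le_antisymm h0 (abs_nonneg u)
        rw [this, Real.log_zero] at hlu64; linarith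
    have hloguN : Real.log |u| ≤ Real.log N₀ := Real.log_le_log hu0 hu
    have he1 : Real.exp 1 ≤ Real.log |u| := by
      have := Real.exp_one_lt_d9; linarith
    have a1 : Real.log |u| / Real.log (Real.log |u|) ≤ Real.log N₀ / Real.log (Real.log N₀) :=
      div_log_mono he1 hloguN
    have a2 : Real.log (Real.log (Real.log |u|)) ≤ Real.log (Real.log (Real.log N₀)) :=
      Real.log_le_log (by linarith) (Real.log_le_log (by linarith) hloguN)
    have hlogL : 0 ≤ Real.log L := Real.log_nonneg (by linarith)
    have hl3 : 0 ≤ Real.log (Real.log (Real.log |u|)) := by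
      apply Real.log_nonneg; linarith
    have hB0 : 0 ≤ Real.log L + 2 * (1 + δ) * Real.log (Real.log (Real.log |u|)) + D * δ⁻¹ ^ 2 := by
      positivity
    have hV0 : 0 ≤ Real.log N₀ / Real.log (Real.log N₀) := by positivity
    calc Real.log |u| / Real.log (Real.log |u|) *
          (Real.log L + 2 * (1 + δ) * Real.log (Real.log (Real.log |u|)) + D * δ⁻¹ ^ 2)
        ≤ Real.log N₀ / Real.log (Real.log N₀) *
          (Real.log L + 2 * (1 + δ) * Real.log (Real.log (Real.log |u|)) + D * δ⁻¹ ^ 2) :=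
          mul_le_mul_of_nonneg_right a1 hB0
      _ ≤ Real.log N₀ / Real.log (Real.log N₀) *
          (Real.log L + 2 * (1 + δ) * Real.log (Real.log (Real.log N₀)) + D * δ⁻¹ ^ 2) := by
          refine mul_le_mul_of_nonneg_left ?_ hV0
          have := mul_le_mul_of_nonneg_left a2 (show (0 : ℝ) ≤ 2 * (1 + δ) by positivity)
          linarith

/-- **The first segment** `Re z = ½ + 1/L`, `|Im z| ≤ N₀`:
`|∫_{−N₀}^{N₀} ‖f(s₀ + iu)‖ du| ≤ 2e√x Z_m · 2N₀`. [cite: BalazardRoton2008, §8.3] -/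
theorem mid_piece_le (hRH : RiemannHypothesis) (hδ0 : 0 < δ) (hD : 0 ≤ D)
    (hP1 : Prop1With δ D T₁) (h18 : Prop18With δ T₁₈) {t₀ Ca : ℝ} {M : ℕ} (hCa : 0 ≤ Ca)
    (hsmall : ∀ σ t : ℝ, 1 / 2 < σ → σ < 1 → |t| ≤ t₀ →
      ‖(riemannZeta (σ + t * I))⁻¹‖ ≤ Ca * (σ - 1 / 2) ^ (-(M : ℝ)))
    (hmid : ∀ t : ℝ, t₀ < t → t ≤ x → MidGood T₁ T₁₈ t) (hN₀e : Real.exp (Real.exp 2) ≤ N₀)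
    (hN₀x : (N₀ : ℝ) ≤ x) (hL4 : 4 ≤ Real.log x) :
    |∫ u in (-(N₀ : ℝ))..N₀, ‖integrand x τ ((1 / 2 + 1 / Real.log x : ℝ) + u * I)‖| ≤
      2 * Real.exp 1 * Real.sqrt x * (Ca * Real.log x ^ M +
        Real.exp (Real.log N₀ / Real.log (Real.log N₀) * (Real.log (Real.log x) +
          2 * (1 + δ) * Real.log (Real.log (Real.log N₀)) + D * δ⁻¹ ^ 2))) * (2 * N₀) := by
  set L := Real.log x with hLdef
  set Zm : ℝ := Ca * L ^ M + Real.exp (Real.log N₀ / Real.log (Real.log N₀) * (Real.log L +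
    2 * (1 + δ) * Real.log (Real.log (Real.log N₀)) + D * δ⁻¹ ^ 2)) with hZm
  have hL0 : 0 < L := by linarith
  obtain ⟨-, -, hN0, hN1, -⟩ := size_facts hN₀e
  have hx0 : 0 < x := by linarith
  have hN₀0 : (0 : ℝ) ≤ N₀ := hN0.le
  have hxs : x ^ (1 / 2 + 1 / L) = Real.sqrt x * Real.exp 1 := by
    rw [Real.rpow_add hx0, Real.sqrt_eq_rpow, Real.rpow_def_of_pos hx0 (1 / L), ← hLdef]
    congr 2; field_simp
  have h := abs_integral_norm_le (g := fun u : ℝ ↦ integrand x τ ((1 / 2 + 1 / L : ℝ) + u * I))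
    (a := -(N₀ : ℝ)) (b := N₀) (C := 2 * Real.exp 1 * Real.sqrt x * Zm) (fun u hu ↦ ?_)
  · have e : |(N₀ : ℝ) - -(N₀ : ℝ)| = 2 * N₀ := by
      rw [sub_neg_eq_add, ← two_mul, abs_of_nonneg (by positivity)]
    rw [e] at h; exact h
  · rw [Set.uIoc_of_le (by linarith), Set.mem_Ioc] at hu
    have hua : |u| ≤ N₀ := abs_le.2 ⟨hu.1.le, hu.2⟩
    set z : ℂ := ((1 / 2 + 1 / L : ℝ) : ℂ) + u * I with hz
    have hzre : z.re = 1 / 2 + 1 / L := by simp [hz]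
    have hL14 : 1 / L ≤ 1 / 4 := one_div_le_one_div_of_le (by norm_num) hL4
    have hz1 : z ≠ 1 := by
      intro h1
      have h2 : (1 : ℝ) / 2 + 1 / L = 1 := by
        have := congrArg Complex.re h1; rw [hzre] at this; simpa using this
      linarith
    have hre : 1 / 2 ≤ z.re := by
      rw [hzre]
      have : 0 < 1 / L := by positivity
      linarith
    -- `‖ζ⁻¹‖ ≤ Zm`
    have hζ : ‖(riemannZeta (((1 / 2 + 1 / L : ℝ) : ℂ) + u * I))⁻¹‖ ≤ Zm := by
      refine norm_inv_zeta_first_le (x := x) hRH hδ0 hD hP1 h18 hCa hsmall hmid hN₀e hN₀x hL4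
        (by linarith) (by linarith) hua (fun hut ↦ ?_)
      -- `1/L ≤ 1/log log |u|` since `log log |u| ≤ log x`
      obtain ⟨-, -, hL₂, -, hcube⟩ := hmid |u| hut (hua.trans hN₀x)
      have hlu : 0 < Real.log |u| := by
        have : (4 : ℝ) ^ 3 ≤ Real.log (Real.log |u|) ^ 3 := pow_le_pow_left₀ (by norm_num) hL₂ 3
        linarith
      have hu0 : 0 < |u| := by
        rcases lt_or_ge 0 |u| with h0 | h0
        · exact h0
        · have : |u| = 0 := le_antisymm h0 (abs_nonneg u)
          rw [this, Real.log_zero] at hlu; exact absurd hlu (lt_irrefl 0)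
      have h1 : Real.log (Real.log |u|) ≤ Real.log |u| - 1 := Real.log_le_sub_one_of_pos hlu
      have h2 : Real.log |u| ≤ L := Real.log_le_log hu0 (hua.trans hN₀x)
      have : 1 / L ≤ 1 / Real.log (Real.log |u|) :=
        one_div_le_one_div_of_le (by linarith) (by linarith)
      simpa using this
    have hB : ‖(x : ℂ) ^ z * (riemannZeta z)⁻¹‖ ≤ Real.sqrt x * Real.exp 1 * Zm := by
      have := norm_cpow_mul_inv_le hx0 (z := z) hζ
      rwa [hzre, hxs] at this
    have hW : 1 ≤ 2 * ‖z - τ * I‖ := by have := half_le_norm_sub hre τ; linarith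
    have := norm_integrand_le (x := x) hz1 hre hB hW
    calc ‖integrand x τ z‖ ≤ Real.sqrt x * Real.exp 1 * Zm * 2 := this
      _ = 2 * Real.exp 1 * Real.sqrt x * Zm := by ring

/-- **The connectors at heights `±N₀`** between `s₀ = ½ + 1/L` and `σ_{N₀}`:
each has `L¹` norm at most `2√x N₀ Z_m`. [cite: BalazardRoton2008, §8.3] -/
theorem midconn_piece_le (hRH : RiemannHypothesis) (hδ0 : 0 < δ) (hD : 0 ≤ D)
    (hP1 : Prop1With δ D T₁) (h18 : Prop18With δ T₁₈) (hN₀ : N₀ = 2 ^ κ) (hT : T = 2 ^ K)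
    (hκ : 1 ≤ κ) (hκK : κ < K) (hTx : (T : ℝ) ≤ x) (hL4 : 4 ≤ Real.log x)
    (hgood : ∀ t : ℝ, (N₀ : ℝ) ≤ t → t ≤ x → GoodSize T₁ T₁₈ t)
    {t₀ Ca : ℝ} {M : ℕ} (hCa : 0 ≤ Ca)
    (hsmall : ∀ σ t : ℝ, 1 / 2 < σ → σ < 1 → |t| ≤ t₀ →
      ‖(riemannZeta (σ + t * I))⁻¹‖ ≤ Ca * (σ - 1 / 2) ^ (-(M : ℝ)))
    (hmid : ∀ t : ℝ, t₀ < t → t ≤ x → MidGood T₁ T₁₈ t) :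
    |∫ v in (1 / 2 + 1 / Real.log x : ℝ)..(absc δ (Real.log x) N₀),
        ‖integrand x τ (v + ((N₀ : ℝ) : ℂ) * I)‖| +
      |∫ v in (absc δ (Real.log x) N₀)..(1 / 2 + 1 / Real.log x : ℝ),
        ‖integrand x τ (v + ((-(N₀ : ℝ) : ℝ) : ℂ) * I)‖| ≤
      2 * (2 * Real.sqrt x * N₀ * (Ca * Real.log x ^ M +
        Real.exp (Real.log N₀ / Real.log (Real.log N₀) * (Real.log (Real.log x) +
          2 * (1 + δ) * Real.log (Real.log (Real.log N₀)) + D * δ⁻¹ ^ 2)))) := by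
  obtain ⟨hN₀2, h2N₀, hN₀T, hx0, hx1, hN₀1, hlogN₀, hlogT⟩ := setup_facts hN₀ hT hκ hκK hTx
  set L := Real.log x with hLdef
  set Zm : ℝ := Ca * L ^ M + Real.exp (Real.log N₀ / Real.log (Real.log N₀) * (Real.log L +
    2 * (1 + δ) * Real.log (Real.log (Real.log N₀)) + D * δ⁻¹ ^ 2)) with hZm
  have hL0 : 0 < L := by linarith
  -- block data at `n = N₀` (its block base is `N₀` itself)
  obtain ⟨⟨hNb, hb1, -, -⟩, hg, hadm, h4, hup, hlog, hlogx, -, -⟩ :=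
    block_data (δ := δ) h18 hN₀ hT hTx hgood le_rfl (by omega)
  have hbb : bbase N₀ = N₀ := le_antisymm hb1 hNb
  rw [hbb] at hg hup hlog
  obtain ⟨-, -, hN₀e, -⟩ := hg
  obtain ⟨hN2, hNe2, hN0, hN1, hN7⟩ := size_facts hN₀e
  have hN₀x : (N₀ : ℝ) ≤ x := by linarith
  have hσ : absc δ L N₀ = 1 / 2 + (lad δ N₀ : ℝ) / L := absc_eq h4
  -- `V_{N₀}/L ≤ 1/log log N₀` and `< 1/2`
  have hLL0 : 0 < Real.log (Real.log (N₀ : ℝ)) := by linarith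
  have hladL : (lad δ N₀ : ℝ) / L ≤ 1 / Real.log (Real.log (N₀ : ℝ)) := by
    rw [div_le_div_iff₀ hL0 hLL0, one_mul]
    calc (lad δ N₀ : ℝ) * Real.log (Real.log (N₀ : ℝ)) ≤
        Real.log (N₀ : ℝ) / Real.log (Real.log (N₀ : ℝ)) * Real.log (Real.log (N₀ : ℝ)) :=
          mul_le_mul_of_nonneg_right hup hLL0.le
      _ = Real.log (N₀ : ℝ) := div_mul_cancel₀ _ hLL0.ne'
      _ ≤ L := hlogN₀.le
  have hladlt : (lad δ N₀ : ℝ) / L < 1 / 2 := by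
    have h1 : (lad δ N₀ : ℝ) / L < 1 / Real.log (Real.log (N₀ : ℝ)) := by
      rw [div_lt_div_iff₀ hL0 hLL0, one_mul]
      calc (lad δ N₀ : ℝ) * Real.log (Real.log (N₀ : ℝ)) ≤ Real.log (N₀ : ℝ) := by
            calc _ ≤ Real.log (N₀ : ℝ) / Real.log (Real.log (N₀ : ℝ)) * Real.log (Real.log (N₀ : ℝ)) :=
                  mul_le_mul_of_nonneg_right hup hLL0.le
              _ = _ := div_mul_cancel₀ _ hLL0.ne'
        _ < L := hlogN₀
    have h2 : 1 / Real.log (Real.log (N₀ : ℝ)) ≤ 1 / 2 := one_div_le_one_div_of_le (by norm_num) hN2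
    linarith
  have h1L : 1 / L ≤ (lad δ N₀ : ℝ) / L := by
    rw [div_le_div_iff_of_pos_right hL0]; linarith
  have hL1pos : 0 < 1 / L := by positivity
  have hsσ : 1 / 2 + 1 / L ≤ absc δ L N₀ := by rw [hσ]; linarith
  have hlen : |absc δ L N₀ - (1 / 2 + 1 / L)| ≤ 1 := by
    rw [hσ, abs_le]
    constructor <;> linarith
  have hlen' : |(1 / 2 + 1 / L) - absc δ L N₀| ≤ 1 := by rw [abs_sub_comm]; exact hlen
  -- pointwise bound at heights `±N₀`
  have hpt : ∀ v : ℝ, v ∈ Ι (1 / 2 + 1 / L) (absc δ L N₀) → ∀ s : ℝ, |s| = (N₀ : ℝ) →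
      ‖integrand x τ (v + s * I)‖ ≤ 2 * Real.sqrt x * N₀ * Zm := by
    intro v hv s hs
    rw [Set.uIoc_of_le hsσ, Set.mem_Ioc, hσ] at hv
    set z : ℂ := (v : ℂ) + s * I with hz
    have hzre : z.re = v := by simp [hz]
    have hzim : z.im = s := by simp [hz]
    have hv1 : v < 1 := by linarith
    have hz1 : z ≠ 1 := by
      intro h1; have := congrArg Complex.re h1; rw [hzre] at this; simp at this; linarith
    have hre : 1 / 2 ≤ z.re := by rw [hzre]; linarith
    have hζ : ‖(riemannZeta ((v : ℂ) + s * I))⁻¹‖ ≤ Zm :=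
      norm_inv_zeta_first_le (x := x) hRH hδ0 hD hP1 h18 hCa hsmall hmid hN₀e hN₀x hL4
        (by linarith) hv1 (by rw [hs]) (fun _ ↦ by rw [hs]; linarith)
    -- `x^v ≤ √x · N₀`
    have hxv : x ^ v ≤ Real.sqrt x * N₀ := by
      have h1 : x ^ v ≤ x ^ (1 / 2 + (lad δ N₀ : ℝ) / L) :=
        Real.rpow_le_rpow_of_exponent_le hx1.le hv.2
      have h2 : x ^ (1 / 2 + (lad δ N₀ : ℝ) / L) = Real.sqrt x * Real.exp (lad δ N₀) := by
        rw [Real.rpow_add hx0, Real.sqrt_eq_rpow, Real.rpow_def_of_pos hx0 ((lad δ N₀ : ℝ) / L),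
          ← hLdef]
        congr 2; field_simp
      have h3 : Real.exp (lad δ N₀ : ℝ) ≤ N₀ := by
        calc Real.exp (lad δ N₀ : ℝ) ≤ Real.exp (Real.log N₀) := Real.exp_le_exp.2 hlog
          _ = N₀ := Real.exp_log hN0
      rw [h2] at h1
      exact h1.trans (mul_le_mul_of_nonneg_left h3 (Real.sqrt_nonneg x))
    have hB : ‖(x : ℂ) ^ z * (riemannZeta z)⁻¹‖ ≤ Real.sqrt x * N₀ * Zm := by
      have := norm_cpow_mul_inv_le hx0 (z := z) hζ
      rw [hzre] at this
      have hZm0 : 0 ≤ Zm := le_trans (norm_nonneg _) hζ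
      exact this.trans (mul_le_mul_of_nonneg_right hxv hZm0)
    have hW : 1 ≤ 2 * ‖z - τ * I‖ := by have := half_le_norm_sub hre τ; linarith
    have := norm_integrand_le (x := x) hz1 hre hB hW
    calc ‖integrand x τ z‖ ≤ Real.sqrt x * N₀ * Zm * 2 := this
      _ = 2 * Real.sqrt x * N₀ * Zm := by ring
  have hC0 : 0 ≤ 2 * Real.sqrt x * N₀ * Zm := by
    have : 0 ≤ Zm := by positivity
    positivity
  have hup' : |∫ v in (1 / 2 + 1 / L : ℝ)..(absc δ L N₀), ‖integrand x τ (v + ((N₀ : ℝ) : ℂ) * I)‖| ≤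
      2 * Real.sqrt x * N₀ * Zm := by
    have h := abs_integral_norm_le (g := fun v : ℝ ↦ integrand x τ (v + ((N₀ : ℝ) : ℂ) * I))
      (a := 1 / 2 + 1 / L) (b := absc δ L N₀) (C := 2 * Real.sqrt x * N₀ * Zm)
      (fun v hv ↦ hpt v hv N₀ (abs_of_nonneg hN0.le))
    exact h.trans (mul_le_of_le_one_right hC0 hlen)
  have hlow' : |∫ v in (absc δ L N₀)..(1 / 2 + 1 / L : ℝ),
      ‖integrand x τ (v + ((-(N₀ : ℝ) : ℝ) : ℂ) * I)‖| ≤ 2 * Real.sqrt x * N₀ * Zm := by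
    have h := abs_integral_norm_le (g := fun v : ℝ ↦ integrand x τ (v + ((-(N₀ : ℝ) : ℝ) : ℂ) * I))
      (a := absc δ L N₀) (b := 1 / 2 + 1 / L) (C := 2 * Real.sqrt x * N₀ * Zm)
      (fun v hv ↦ hpt v (by rwa [Set.uIoc_comm]) (-(N₀ : ℝ)) (by rw [abs_neg, abs_of_nonneg hN0.le]))
    exact h.trans (mul_le_of_le_one_right hC0 hlen')
  linarith

/-- **The end connectors at heights `±T`** between `σ_{T−1}` and `c = 1 + 1/L` (for `|τ| ≤ T/4`,
`x ≤ 4T`): together at most `32 (e^{E_{T−1}} + e^{D V_{T−1} δ⁻¹})`. [cite: BalazardRoton2008, §8.3] -/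
theorem end_piece_le (hRH : RiemannHypothesis) (hδ0 : 0 < δ) (hδ1 : δ ≤ 1)
    (hP1 : Prop1With δ D T₁) (h18 : Prop18With δ T₁₈) (hN₀ : N₀ = 2 ^ κ) (hT : T = 2 ^ K)
    (hκ : 1 ≤ κ) (hκK : κ < K) (hTx : (T : ℝ) ≤ x) (hxT : x ≤ 4 * T) (hL4 : 4 ≤ Real.log x)
    (hgood : ∀ t : ℝ, (N₀ : ℝ) ≤ t → t ≤ x → GoodSize T₁ T₁₈ t) (hτ : |τ| ≤ T / 4) :
    |∫ v in (absc δ (Real.log x) (T - 1))..(1 + 1 / Real.log x : ℝ),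
        ‖integrand x τ (v + ((T : ℝ) : ℂ) * I)‖| +
      |∫ v in (absc δ (Real.log x) (T - 1))..(1 + 1 / Real.log x : ℝ),
        ‖integrand x τ (v + ((-(T : ℝ) : ℝ) : ℂ) * I)‖| ≤
      32 * (Real.exp (blockE δ (max D 0 + 2) (Real.log x) (T - 1)) +
        Real.exp (D * (lad δ (T - 1)) * δ⁻¹)) := by
  obtain ⟨hN₀2, h2N₀, hN₀T, hx0, hx1, hN₀1, hlogN₀, hlogT⟩ := setup_facts hN₀ hT hκ hκK hTx
  set L := Real.log x with hLdef
  have hL0 : 0 < L := by linarith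
  have hT1 : 1 ≤ T := by omega
  have hTm1 : ((T - 1 : ℕ) : ℝ) = (T : ℝ) - 1 := by rw [Nat.cast_sub hT1, Nat.cast_one]
  obtain ⟨⟨hNb, hb1, hb2, hbT⟩, hg, hadm, h4, hup, hlog, hlogx, hbn, -⟩ :=
    block_data (δ := δ) h18 hN₀ hT hTx hgood (show N₀ ≤ T - 1 by omega) (by omega)
  obtain ⟨hT₁, -, hTe, -⟩ := hg
  obtain ⟨hB2, hBe2, hB0, hB1, hB7⟩ := size_facts hTe
  have hσ : absc δ L (T - 1) = 1 / 2 + (lad δ (T - 1) : ℝ) / L := absc_eq h4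
  set Zend : ℝ := Real.exp (blockE δ (max D 0 + 2) L (T - 1)) +
    Real.exp (D * (lad δ (T - 1)) * δ⁻¹) with hZend
  have hZend0 : 0 ≤ Zend := by positivity
  -- `V_{T−1}/L ≤ 1/2`, so `σ_{T−1} ≤ 1 < c`
  have hLLB : 0 < Real.log (Real.log (bbase (T - 1) : ℝ)) := by linarith
  have hladL : (lad δ (T - 1) : ℝ) / L ≤ 1 / 2 := by
    have h1 : (lad δ (T - 1) : ℝ) / L ≤ 1 / Real.log (Real.log (bbase (T - 1) : ℝ)) := by
      rw [div_le_div_iff₀ hL0 hLLB, one_mul]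
      calc (lad δ (T - 1) : ℝ) * Real.log (Real.log (bbase (T - 1) : ℝ)) ≤
          Real.log (bbase (T - 1) : ℝ) / Real.log (Real.log (bbase (T - 1) : ℝ)) *
            Real.log (Real.log (bbase (T - 1) : ℝ)) := mul_le_mul_of_nonneg_right hup hLLB.le
        _ = Real.log (bbase (T - 1) : ℝ) := div_mul_cancel₀ _ hLLB.ne'
        _ ≤ L := hlogx
    exact h1.trans (one_div_le_one_div_of_le (by norm_num) hB2)
  have hL14 : 1 / L ≤ 1 / 4 := one_div_le_one_div_of_le (by norm_num) hL4
  have hL1pos : 0 < 1 / L := by positivity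
  have hσc : absc δ L (T - 1) ≤ 1 + 1 / L := by rw [hσ]; linarith
  have hlen : |(1 + 1 / L) - absc δ L (T - 1)| ≤ 1 := by
    rw [abs_of_nonneg (by linarith), hσ]
    have : 0 ≤ (lad δ (T - 1) : ℝ) / L := by positivity
    linarith
  -- `x^c = e·x`
  have hxc : x ^ (1 + 1 / L) = x * Real.exp 1 := by
    rw [Real.rpow_add hx0, Real.rpow_one, Real.rpow_def_of_pos hx0 (1 / L), ← hLdef]
    congr 2; field_simp
  have hT0 : (0 : ℝ) < T := by exact_mod_cast (show 0 < T by omega)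
  -- pointwise bound at heights `±T`
  have hpt : ∀ v : ℝ, v ∈ Ι (absc δ L (T - 1)) (1 + 1 / L) → ∀ s : ℝ, |s| = (T : ℝ) →
      ‖integrand x τ (v + s * I)‖ ≤ 16 * Zend := by
    intro v hv s hs
    rw [Set.uIoc_of_le hσc, Set.mem_Ioc, hσ] at hv
    set z : ℂ := (v : ℂ) + s * I with hz
    have hzre : z.re = v := by simp [hz]
    have hzim : z.im = s := by simp [hz]
    have hz1 : z ≠ 1 := by
      intro h1; have := congrArg Complex.im h1; rw [hzim] at this; simp at this
      rw [this, abs_zero] at hs; linarith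
    have hre : 1 / 2 ≤ z.re := by
      rw [hzre]
      have : 0 ≤ (lad δ (T - 1) : ℝ) / L := by positivity
      linarith
    have hζ : ‖(riemannZeta ((v : ℂ) + s * I))⁻¹‖ ≤ Zend := by
      have := norm_inv_zeta_end_le hRH hδ0 hδ1 hP1 hT₁ hTe hadm (t := T)
        (by rw [hTm1]; linarith) (by rw [hTm1]; linarith) hlogx (σ := v) (by linarith)
        (by linarith) hs
      rw [hZend]; exact this
    have hxv : x ^ v ≤ x * Real.exp 1 := by
      rw [← hxc]; exact Real.rpow_le_rpow_of_exponent_le hx1.le hv.2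
    have hB : ‖(x : ℂ) ^ z * (riemannZeta z)⁻¹‖ ≤ x * Real.exp 1 * Zend := by
      have := norm_cpow_mul_inv_le hx0 (z := z) hζ
      rw [hzre] at this
      exact this.trans (mul_le_mul_of_nonneg_right hxv hZend0)
    -- `‖z − iτ‖ ≥ 3T/4`
    have hW : 1 ≤ 4 / (3 * T) * ‖z - τ * I‖ := by
      have hI : |z.im - τ| ≤ ‖z - τ * I‖ := by
        have h := Complex.abs_im_le_norm (z - τ * I)
        rwa [im_sub_mul_I] at h
      have h34 : 3 * T / 4 ≤ |z.im - τ| := by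
        rw [hzim]
        have h1 : |s| - |τ| ≤ |s - τ| := abs_sub_abs_le_abs_sub s τ
        rw [hs] at h1; linarith
      rw [div_mul_eq_mul_div, le_div_iff₀ (by positivity)]
      linarith
    have hf := norm_integrand_le (x := x) hz1 hre hB hW
    have he3 : Real.exp 1 ≤ 3 := by
      have := Real.exp_one_lt_d9
      linarith
    have hkey : x * (4 / (3 * (T : ℝ))) ≤ 16 / 3 := by
      have e1 : x * (4 / (3 * (T : ℝ))) = 4 / 3 * (x / T) := by ring
      have hxT' : x / T ≤ 4 := by rw [div_le_iff₀ hT0]; linarith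
      rw [e1]; linarith
    have h1 : x * Real.exp 1 * Zend * (4 / (3 * T)) = Real.exp 1 * Zend * (x * (4 / (3 * T))) := by
      ring
    rw [h1] at hf
    have h2 : Real.exp 1 * Zend * (x * (4 / (3 * T))) ≤ Real.exp 1 * Zend * (16 / 3) :=
      mul_le_mul_of_nonneg_left hkey (by positivity)
    have h3 : Real.exp 1 * Zend * (16 / 3) ≤ 3 * Zend * (16 / 3) :=
      mul_le_mul_of_nonneg_right (mul_le_mul_of_nonneg_right he3 hZend0) (by norm_num)
    linarith
  have hC0 : 0 ≤ 16 * Zend := by positivity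
  have hup' : |∫ v in (absc δ L (T - 1))..(1 + 1 / L : ℝ), ‖integrand x τ (v + ((T : ℝ) : ℂ) * I)‖| ≤
      16 * Zend := by
    have h := abs_integral_norm_le (g := fun v : ℝ ↦ integrand x τ (v + ((T : ℝ) : ℂ) * I))
      (a := absc δ L (T - 1)) (b := 1 + 1 / L) (C := 16 * Zend)
      (fun v hv ↦ hpt v hv T (abs_of_nonneg hT0.le))
    exact h.trans (mul_le_of_le_one_right hC0 hlen)
  have hlow' : |∫ v in (absc δ L (T - 1))..(1 + 1 / L : ℝ),
      ‖integrand x τ (v + ((-(T : ℝ) : ℝ) : ℂ) * I)‖| ≤ 16 * Zend := by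
    have h := abs_integral_norm_le (g := fun v : ℝ ↦ integrand x τ (v + ((-(T : ℝ) : ℝ) : ℂ) * I))
      (a := absc δ L (T - 1)) (b := 1 + 1 / L) (C := 16 * Zend)
      (fun v hv ↦ hpt v hv (-(T : ℝ)) (by rw [abs_neg, abs_of_nonneg hT0.le]))
    exact h.trans (mul_le_of_le_one_right hC0 hlen)
  linarith

/-! ### Assembly -/

/-- **Balazard–de Roton 2008, Proposition 22 (twisted form, before the dyadic evaluation).**
Under RH and the conclusions of Props. 1 and 18 (hypotheses `hP1`, `h18`), with `N₀ = 2^κ`,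
`T = 2^K` (`1 ≤ κ < K`), `T ≤ x ≤ 4T`, `log x ≥ 4`, all sizes in `[N₀, x]` good, a bound `hsmall`
for `ζ⁻¹` at heights `≤ t₀` and all heights in `(t₀, x]` mid-good, `c = 1 + 1/log x` and
`|τ| ≤ T/4`:
`‖∫_{-T}^{T} ζ(c+iu)⁻¹ x^{c+iu}/(c+iu−iτ) du‖ ≤ √x·(24 Σ_{N₀≤n<T} e^{E_n}(1/(1+|n−τ|) + 1/(1+|n+τ|)) + 16 N₀ Z_m)`
`+ 32 (e^{E_{T−1}} + e^{D V_{T−1} δ⁻¹})`. [cite: BalazardRoton2008, Prop. 22; BalazardDeRoton2010, §6.2 (t46)] -/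
theorem norm_perron_integral_le (hRH : RiemannHypothesis) (hδ0 : 0 < δ) (hδ1 : δ ≤ 1)
    (hD : 0 ≤ D) (hP1 : Prop1With δ D T₁) (h18 : Prop18With δ T₁₈) (hN₀ : N₀ = 2 ^ κ)
    (hT : T = 2 ^ K) (hκ : 1 ≤ κ) (hκK : κ < K) (hTx : (T : ℝ) ≤ x) (hxT : x ≤ 4 * T)
    (hL4 : 4 ≤ Real.log x) (hgood : ∀ t : ℝ, (N₀ : ℝ) ≤ t → t ≤ x → GoodSize T₁ T₁₈ t)
    {t₀ Ca : ℝ} {M : ℕ} (hCa : 0 ≤ Ca)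
    (hsmall : ∀ σ t : ℝ, 1 / 2 < σ → σ < 1 → |t| ≤ t₀ →
      ‖(riemannZeta (σ + t * I))⁻¹‖ ≤ Ca * (σ - 1 / 2) ^ (-(M : ℝ)))
    (hmid : ∀ t : ℝ, t₀ < t → t ≤ x → MidGood T₁ T₁₈ t) {c : ℝ} (hc : c = 1 + 1 / Real.log x)
    (hτ : |τ| ≤ T / 4) :
    ‖∫ u in (-(T : ℝ))..T, (riemannZeta (c + u * I))⁻¹ *
        ((x : ℂ) ^ ((c : ℂ) + u * I) / ((c : ℂ) + u * I - τ * I))‖ ≤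
      Real.sqrt x * (24 * ∑ n ∈ Finset.Ico N₀ T, Real.exp (blockE δ (max D 0 + 2) (Real.log x) n) *
            (1 / (1 + |(n : ℝ) - τ|) + 1 / (1 + |(n : ℝ) + τ|)) +
          16 * N₀ * (Ca * Real.log x ^ M + Real.exp (Real.log N₀ / Real.log (Real.log N₀) *
            (Real.log (Real.log x) + 2 * (1 + δ) * Real.log (Real.log (Real.log N₀)) + D * δ⁻¹ ^ 2)))) +
        32 * (Real.exp (blockE δ (max D 0 + 2) (Real.log x) (T - 1)) +
          Real.exp (D * (lad δ (T - 1)) * δ⁻¹)) := by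
  obtain ⟨hN₀2, h2N₀, hN₀T, hx0, hx1, hN₀1, hlogN₀, hlogT⟩ := setup_facts hN₀ hT hκ hκK hTx
  set L := Real.log x with hLdef
  have hL0 : 0 < L := by linarith
  have hc1 : 1 / 2 < c := by rw [hc]; have : 0 < 1 / L := by positivity
                             linarith
  have hs₀ : (1 : ℝ) / 2 < 1 / 2 + 1 / L := by have : 0 < 1 / L := by positivity
                                               linarith
  have hNT : N₀ < T := by omega
  have hT1 : 1 ≤ T := by omega
  -- rewrite the integrand as `f(c + iu)`
  have hcongr : (∫ u in (-(T : ℝ))..T, (riemannZeta (c + u * I))⁻¹ *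
      ((x : ℂ) ^ ((c : ℂ) + u * I) / ((c : ℂ) + u * I - τ * I))) =
      ∫ u in (-(T : ℝ))..T, integrand x τ (c + u * I) := by
    refine intervalIntegral.integral_congr fun u _ ↦ ?_
    have hne : (c : ℂ) + u * I ≠ 1 := by
      intro h; have := congrArg Complex.re h; simp at this; rw [this] at hc1
      -- `c = 1` contradicts `c = 1 + 1/L > 1`
      have : (0 : ℝ) < 1 / L := by positivity
      linarith
    simp only [integrand, zetaInv_of_ne_one hne]
  rw [hcongr]
  -- the staircase
  have hstair := StaircaseSymm.norm_integral_symm_staircase_le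
    (differentiableOn_integrand hRH hx0 τ) hc1 hNT (absc δ L) (fun n ↦ half_lt_absc hL0 n) hs₀
  -- (1) vertical unit pieces
  set w : ℕ → ℝ := fun n ↦ 1 / (1 + |(n : ℝ) - τ|) + 1 / (1 + |(n : ℝ) + τ|) with hw
  set E : ℕ → ℝ := fun n ↦ Real.exp (blockE δ (max D 0 + 2) L n) with hE
  have hw0 : ∀ n, 0 ≤ w n := fun n ↦ by positivity
  have hE0 : ∀ n, 0 ≤ E n := fun n ↦ (Real.exp_pos _).le
  have hw2 : ∀ n : ℕ, w n ≤ 2 * w (n + 1) := fun n ↦ by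
    obtain ⟨a, b⟩ := weight_shift (n : ℝ) τ
    simp only [hw, Nat.cast_add, Nat.cast_one]
    linarith
  have h1 : (∑ n ∈ Finset.Ico N₀ T, (|∫ u in (n : ℝ)..((n : ℝ) + 1), ‖integrand x τ (absc δ L n + u * I)‖| +
      |∫ u in (-((n : ℝ) + 1))..(-(n : ℝ)), ‖integrand x τ (absc δ L n + u * I)‖|)) ≤
      6 * Real.sqrt x * ∑ n ∈ Finset.Ico N₀ T, E n * w n := by
    rw [Finset.mul_sum]
    refine Finset.sum_le_sum fun n hn ↦ ?_
    rw [Finset.mem_Ico] at hn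
    have := vert_piece_le (τ := τ) hδ0 hδ1 hP1 h18 hN₀ hT hTx hL0 hgood hn.1 hn.2
    simp only [hE, hw]
    linarith
  -- (2) connectors
  have h2 : (∑ n ∈ Finset.Ico N₀ (T - 1), (|∫ v in (absc δ L n)..(absc δ L (n + 1)),
        ‖integrand x τ (v + (((n : ℝ) + 1 : ℝ) : ℂ) * I)‖| +
      |∫ v in (absc δ L (n + 1))..(absc δ L n), ‖integrand x τ (v + ((-((n : ℝ) + 1) : ℝ) : ℂ) * I)‖|)) ≤
      18 * Real.sqrt x * ∑ n ∈ Finset.Ico N₀ T, E n * w n := by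
    have hstep : (∑ n ∈ Finset.Ico N₀ (T - 1), (|∫ v in (absc δ L n)..(absc δ L (n + 1)),
        ‖integrand x τ (v + (((n : ℝ) + 1 : ℝ) : ℂ) * I)‖| +
        |∫ v in (absc δ L (n + 1))..(absc δ L n), ‖integrand x τ (v + ((-((n : ℝ) + 1) : ℝ) : ℂ) * I)‖|)) ≤
        ∑ n ∈ Finset.Ico N₀ (T - 1), 6 * Real.sqrt x * ((E n + E (n + 1)) * w n) := by
      refine Finset.sum_le_sum fun n hn ↦ ?_
      rw [Finset.mem_Ico] at hn
      have := conn_piece_le (τ := τ) hδ0 hδ1 hP1 h18 hN₀ hT hTx hL0 hgood hn.1 (by omega)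
      simp only [hE, hw]
      linarith
    refine hstep.trans ?_
    rw [← Finset.mul_sum]
    have hsx : 0 ≤ 6 * Real.sqrt x := by positivity
    -- `Σ_{n<T−1} (E n + E (n+1)) w n ≤ 3 Σ_{n<T} E n w n`
    have hA : ∑ n ∈ Finset.Ico N₀ (T - 1), E n * w n ≤ ∑ n ∈ Finset.Ico N₀ T, E n * w n :=
      Finset.sum_le_sum_of_subset_of_nonneg (Finset.Ico_subset_Ico_right (by omega))
        (fun n _ _ ↦ mul_nonneg (hE0 n) (hw0 n))
    have hB : ∑ n ∈ Finset.Ico N₀ (T - 1), E (n + 1) * w n ≤ 2 * ∑ n ∈ Finset.Ico N₀ T, E n * w n := by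
      calc ∑ n ∈ Finset.Ico N₀ (T - 1), E (n + 1) * w n
          ≤ ∑ n ∈ Finset.Ico N₀ (T - 1), 2 * (E (n + 1) * w (n + 1)) :=
            Finset.sum_le_sum fun n _ ↦ by
              have := mul_le_mul_of_nonneg_left (hw2 n) (hE0 (n + 1)); linarith
        _ = 2 * ∑ n ∈ Finset.Ico (N₀ + 1) T, E n * w n := by
            rw [← Finset.mul_sum, Finset.sum_Ico_add' (fun m ↦ E m * w m) N₀ (T - 1) 1,
              Nat.sub_add_cancel hT1]
        _ ≤ 2 * ∑ n ∈ Finset.Ico N₀ T, E n * w n := by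
            refine mul_le_mul_of_nonneg_left ?_ (by norm_num)
            exact Finset.sum_le_sum_of_subset_of_nonneg (Finset.Ico_subset_Ico_left (by omega))
              (fun n _ _ ↦ mul_nonneg (hE0 n) (hw0 n))
    have hsplit : ∑ n ∈ Finset.Ico N₀ (T - 1), (E n + E (n + 1)) * w n =
        (∑ n ∈ Finset.Ico N₀ (T - 1), E n * w n) + ∑ n ∈ Finset.Ico N₀ (T - 1), E (n + 1) * w n := by
      rw [← Finset.sum_add_distrib]; refine Finset.sum_congr rfl fun n _ ↦ by ring
    rw [hsplit]
    nlinarith [Finset.sum_nonneg (fun n (_ : n ∈ Finset.Ico N₀ T) ↦ mul_nonneg (hE0 n) (hw0 n))]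
  -- (3), (4) first segment and its connectors
  set Zm : ℝ := Ca * L ^ M + Real.exp (Real.log N₀ / Real.log (Real.log N₀) * (Real.log L +
    2 * (1 + δ) * Real.log (Real.log (Real.log N₀)) + D * δ⁻¹ ^ 2)) with hZm
  have hZm0 : 0 ≤ Zm := by positivity
  obtain ⟨⟨hNb, hb1, -, -⟩, hg, -⟩ := block_data (δ := δ) h18 hN₀ hT hTx hgood (le_refl N₀) hNT
  have hbb : bbase N₀ = N₀ := le_antisymm hb1 hNb
  rw [hbb] at hg
  have hN₀e : Real.exp (Real.exp 2) ≤ N₀ := hg.2.2.1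
  have hN₀x : (N₀ : ℝ) ≤ x := by linarith
  have h3 := mid_piece_le (τ := τ) hRH hδ0 hD hP1 h18 hCa hsmall hmid hN₀e hN₀x hL4
  have h4 := midconn_piece_le (τ := τ) hRH hδ0 hD hP1 h18 hN₀ hT hκ hκK hTx hL4 hgood hCa hsmall hmid
  -- (5) ends
  have h5 := end_piece_le hRH hδ0 hδ1 hP1 h18 hN₀ hT hκ hκK hTx hxT hL4 hgood hτ
  -- put together
  have he : Real.exp 1 ≤ 3 := by
    have := Real.exp_one_lt_d9
    linarith
  have hmid_tot : 2 * Real.exp 1 * Real.sqrt x * Zm * (2 * N₀) + 2 * (2 * Real.sqrt x * N₀ * Zm) ≤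
      Real.sqrt x * (16 * N₀ * Zm) := by
    have h0 : 0 ≤ Real.sqrt x * N₀ * Zm := by positivity
    nlinarith
  rw [hc] at hstair ⊢
  have hS0 : 0 ≤ ∑ n ∈ Finset.Ico N₀ T, E n * w n :=
    Finset.sum_nonneg (fun n _ ↦ mul_nonneg (hE0 n) (hw0 n))
  have hfinal := hstair.trans (by linarith [h1, h2, h3, h4, h5, hmid_tot] :
    _ ≤ Real.sqrt x * (24 * ∑ n ∈ Finset.Ico N₀ T, E n * w n + 16 * N₀ * Zm) +
      32 * (Real.exp (blockE δ (max D 0 + 2) L (T - 1)) + Real.exp (D * (lad δ (T - 1)) * δ⁻¹)))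
  simpa only [hE, hw, hZm] using hfinal

end pieces

end SoundContour

end Literature.NumberTheory.LFunctions

end
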